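import Summits.HubbardSuperconductivity.HubbardSuperconductivity.Theorems.KacWindowPenaltyWindowGapPenalisedForms

/-!
# Route `KacWindowPenalty` — crux `WindowGap` (stmt-HubbardSuperconductivity-1088),
# line `sector-invisible-dressing`: removing the `d`-wave pair source

The line dresses the penalised Hubbard torus with a `d`-wave pair SOURCE `-h(Δ_d + Δ_dᴴ)`,
`Δ_d = pairField dWaveFormFactor L`, and must remove it at the end. This support file records the
removal cost, with no physics: switching on the source lowers the whole-space minimum energy
`minEnergyOn · ⊤` of ANY matrix `Y` by at most `h · sup_{‖ψ‖ = 1} Re ⟨ψ, (Δ_d + Δ_dᴴ) ψ⟩ ≤ 8√2 · h · L²`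
(`stub_sourceRemoval`). The operator bound is Cauchy–Schwarz, `Re ⟨ψ, (Δ_d + Δ_dᴴ) ψ⟩ ≤ 2‖Δ_d ψ‖`
(`re_dotProduct_pairSource_mulVec_le`), and the Parseval pair sum-rule ceiling
`‖Δ_d ψ‖² = Re ⟨ψ, Δ_dᴴ Δ_d ψ⟩ ≤ L² · Re ⟨ψ, W_0 ψ⟩ ≤ 32 L⁴`, i.e. `‖Δ_d ψ‖ ≤ 4√2 L²` on unit vectors
(`norm_toLp_pairField_mulVec_le`, from the landed
`re_expect_pairField_div_le_re_dotProduct_kacWindow_mulVec` and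
`re_dotProduct_kacWindow_mulVec_le_apriori`).

Sources: H. Tasaki, *Physics and Mathematics of Quantum Many-Body Systems* (2020) §2.1
(variational principle); T. Kennedy, E. H. Lieb, B. S. Shastry, PRL 61 (1988) 2582 (Parseval sum
rule); D. J. Scalapino, Phys. Rep. 250 (1995) 329 §2 (the `d`-wave pair field). Folklore
finite-dimensional bookkeeping over the tree's definitions; no new definitions.
-/

-- the mandated namespace `Summit.<Summit>.<Problem>.Theorems` repeats `HubbardSuperconductivity`
-- (single-problem summit, D-0017), which the `dupNamespace` linter flags on every declaration
set_option linter.dupNamespace false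

namespace Summit.HubbardSuperconductivity.HubbardSuperconductivity.Theorems

open Matrix Literature.MathematicalPhysics.QuantumLattice

/-- **The `d`-wave pair field is bounded by `4√2 L²` on unit vectors**: for every Fock vector `ψ`
with `⟨ψ, ψ⟩ = 1`, `‖Δ_d ψ‖ ≤ 4√2 L²`. Indeed `‖Δ_d ψ‖² = Re ⟨ψ, Δ_dᴴ Δ_d ψ⟩` is `L²` times the
zero mode of the window weight, `≤ L² · Re ⟨ψ, W_0 ψ⟩`
(`re_expect_pairField_div_le_re_dotProduct_kacWindow_mulVec`), and `Re ⟨ψ, W_0 ψ⟩ ≤ 32 L²`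
(`re_dotProduct_kacWindow_mulVec_le_apriori`, Parseval). Kennedy–Lieb–Shastry, PRL 61 (1988)
2582; Scalapino, Phys. Rep. 250 (1995) 329, §2. [folklore] -/
theorem norm_toLp_pairField_mulVec_le (L : ℕ) [NeZero L] (ψ : Fock (Orb (FermionTorus 2 L)))
    (hψ : star ψ ⬝ᵥ ψ = 1) :
    ‖(WithLp.toLp 2 (pairField dWaveFormFactor L *ᵥ ψ) :
        EuclideanSpace ℂ (Finset (Orb (FermionTorus 2 L))))‖ ≤ 4 * Real.sqrt 2 * (L : ℝ) ^ 2 := by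
  have hL : (0 : ℝ) < (L : ℝ) := Nat.cast_pos.2 (Nat.pos_of_ne_zero (NeZero.ne L))
  have hL2 : (0 : ℝ) < (L : ℝ) ^ 2 := by positivity
  have hexp : (expect ((pairField dWaveFormFactor L)ᴴ * pairField dWaveFormFactor L) ψ).re ≤
      32 * (L : ℝ) ^ 2 * (L : ℝ) ^ 2 :=
    (div_le_iff₀ hL2).1 ((re_expect_pairField_div_le_re_dotProduct_kacWindow_mulVec L 0 ψ).trans
      (re_dotProduct_kacWindow_mulVec_le_apriori L 0 ψ hψ))
  refine le_of_pow_le_pow_left₀ two_ne_zero (by positivity) ?_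
  rw [norm_toLp_sq_eq_re, ← PosSemidefTrace.expect_conjTranspose_mul]
  calc (expect ((pairField dWaveFormFactor L)ᴴ * pairField dWaveFormFactor L) ψ).re
      ≤ 32 * (L : ℝ) ^ 2 * (L : ℝ) ^ 2 := hexp
    _ = (4 * Real.sqrt 2 * (L : ℝ) ^ 2) ^ 2 := by
        rw [mul_pow, mul_pow, Real.sq_sqrt zero_le_two]; ring

/-- **The pair source is bounded by `8√2 L²` on unit vectors**: for every Fock vector `ψ` with
`⟨ψ, ψ⟩ = 1`, `Re ⟨ψ, (Δ_d + Δ_dᴴ) ψ⟩ ≤ 8√2 L²`: both `Re ⟨ψ, Δ_d ψ⟩` and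
`Re ⟨ψ, Δ_dᴴ ψ⟩ = Re ⟨Δ_d ψ, ψ⟩` are at most `‖ψ‖ ‖Δ_d ψ‖ = ‖Δ_d ψ‖ ≤ 4√2 L²` (Cauchy–Schwarz,
`re_star_dotProduct_le_norm_mul_norm`, and `norm_toLp_pairField_mulVec_le`).
Scalapino, Phys. Rep. 250 (1995) 329, §2. [folklore] -/
theorem re_dotProduct_pairSource_mulVec_le (L : ℕ) [NeZero L]
    (ψ : Fock (Orb (FermionTorus 2 L))) (hψ : star ψ ⬝ᵥ ψ = 1) :
    (star ψ ⬝ᵥ (pairField dWaveFormFactor L + (pairField dWaveFormFactor L)ᴴ) *ᵥ ψ).re ≤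
      8 * Real.sqrt 2 * (L : ℝ) ^ 2 := by
  have hn := norm_toLp_pairField_mulVec_le L ψ hψ
  have h1 : ‖(WithLp.toLp 2 ψ : EuclideanSpace ℂ (Finset (Orb (FermionTorus 2 L))))‖ = 1 := by
    rw [← Real.sqrt_sq (norm_nonneg _), norm_toLp_sq_eq_re, hψ, Complex.one_re, Real.sqrt_one]
  have ha := re_star_dotProduct_le_norm_mul_norm ψ (pairField dWaveFormFactor L *ᵥ ψ)
  have hb := re_star_dotProduct_le_norm_mul_norm (pairField dWaveFormFactor L *ᵥ ψ) ψ
  rw [h1, one_mul] at ha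
  rw [h1, mul_one] at hb
  rw [add_mulVec, dotProduct_add, Complex.add_re,
    dotProduct_mulVec (star ψ) (pairField dWaveFormFactor L)ᴴ ψ, ← star_mulVec]
  linarith

/-- **Source removal** (line `sector-invisible-dressing`, stub `stub_sourceRemoval`). For every
matrix `Y` on the Fock space of the fermionic torus of side `L` and every `h ≥ 0`, dressing `Y`
with the `d`-wave pair source `-h(Δ_d + Δ_dᴴ)`, `Δ_d = pairField dWaveFormFactor L`, lowers the
whole-space minimum energy by at most `8√2 · h · L²`:
`minEnergyOn Y ⊤ - 8√2 h L² ≤ minEnergyOn (Y - h(Δ_d + Δ_dᴴ)) ⊤`. Proof: `le_csInf` over the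
unit sphere (nonempty: the basis vector at `∅`); for a unit `ψ`,
`Re ⟨ψ, (Y - h(Δ_d + Δ_dᴴ)) ψ⟩ = Re ⟨ψ, Y ψ⟩ - h Re ⟨ψ, (Δ_d + Δ_dᴴ) ψ⟩ ≥ minEnergyOn Y ⊤ - 8√2 h L²`
by the variational principle (`minEnergyOn_le_re_rayleigh`) and
`re_dotProduct_pairSource_mulVec_le`. Tasaki (2020) §2.1; Scalapino, Phys. Rep. 250 (1995) 329,
§2. [folklore] -/
theorem stub_sourceRemoval (L : ℕ) [NeZero L]
    (Y : Matrix (Finset (Orb (FermionTorus 2 L))) (Finset (Orb (FermionTorus 2 L))) ℂ) (h : ℝ)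
    (hh : 0 ≤ h) :
    Y.minEnergyOn ⊤ - 8 * Real.sqrt 2 * h * (L : ℝ) ^ 2 ≤
      (Y - (h : ℂ) • (pairField dWaveFormFactor L + (pairField dWaveFormFactor L)ᴴ)).minEnergyOn ⊤ := by
  classical
  -- the unit sphere is nonempty: the basis vector at the empty configuration
  have hψ₀ : star (Pi.single (∅ : Finset (Orb (FermionTorus 2 L))) (1 : ℂ)) ⬝ᵥ
      Pi.single (∅ : Finset (Orb (FermionTorus 2 L))) (1 : ℂ) = 1 := by
    simp
  refine le_csInf ⟨_, _, Submodule.mem_top, hψ₀, rfl⟩ ?_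
  rintro E ⟨ψ, -, hψ, rfl⟩
  have hY := minEnergyOn_le_re_rayleigh Y ⊤ Submodule.mem_top hψ
  have hS := mul_le_mul_of_nonneg_left (re_dotProduct_pairSource_mulVec_le L ψ hψ) hh
  rw [sub_mulVec, smul_mulVec, dotProduct_sub, dotProduct_smul, smul_eq_mul, Complex.sub_re,
    Complex.re_ofReal_mul]
  linarith

end Summit.HubbardSuperconductivity.HubbardSuperconductivity.Theorems
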